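import Summits.ResolutionOfSingularities.ResolutionOfSingularities.Theorems.RadicialJungCleanModelsGiraudCaseAB
import Summits.ResolutionOfSingularities.ResolutionOfSingularities.Theorems.RadicialJungCleanModelsGiraudExactness
import Summits.ResolutionOfSingularities.ResolutionOfSingularities.Theorems.RadicialJungCleanModelsGiraudCoprincipalPart
import HarnessLib

/-!
# Route `RadicialJung`, crux `CleanModels` (stmt-15917): Giraud's Lemme 2.3 at ONE point of the
# blow-up — the colength `c` drops (T2 brick B4: the chart-level input of `stub_step`)

Support file (OURS) for PROGRAMME-clean-dim2 / T2 (`HOME/L/res-L0-w81-pv-2/g5/T2Skeleton.lean`,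
`stub_step`; architecture `T2-ARCHITECTURE.md` §B4/B5), line `via-clean-models` of the crux
`DescentPerfectToAll` (stmt-0549). Nothing here is a statement of Hironaka's manuscript.

J. Giraud, Bull. SMF 111 (1983), Lemme 2.3 (p. 117): blow up a point `ξ ∈ Sing(X, ω)`; for
`ξ′` on the exceptional curve, "(i) Si `ξ` est un point de croisement de `E(ω)`:
`Σ (k(ξ′):k(ξ))·c(X′,ω′,ξ′) ≤ c(X,ω,ξ) − m(m+1)/2`. (ii) Si `ξ` n'est pas un point de croisement:
`(k(ξ′):k(ξ))·c(X′,ω′,ξ′) ≤ c(X,ω,ξ) − m(m−1)/2`. (iii) Si `ω = df`, si `ξ` n'est pas un point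
de croisement, si `c(X′,ω′,ξ′) = c(X,ω,ξ)`, alors `m = 1` et `ξ′` est le point de croisement de
`E(ω′)`." Here these are read AT ONE POINT `ξ′` = a maximal ideal `Q` of a chart ring
`A = R[y/x]` (resp. `R[x/y]`) of the two-dimensional regular local ring `(R, 𝔪 = (x, y)) ⊆ K`,
with local ring `T = A_Q`, for an ideal `J′ ⊆ T` (the log-Jacobian ideal of the transform at
`ξ′`) GIVEN through the chart dictionary of `RadicialJungCleanModelsLogContentIdealBlowup.lean`
((C1): `J′ = J·T`; (C2): `J′ = xᵃ·D′·T`) as `J′ = (g)·(D♯A)T` for the relevant `R`-ideal `D♯`;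
`c′ := λ_T(T/D(J′))` with `D(J′) = coprincipalPart J′` (Giraud's `D(I) = I·B(I)⁻¹`) and
`c := λ_R(R/D)`, `D = D(J)` of order `m ≥ 1`:

* `le_coprincipalPart_of_span_singleton_mul_le` — `J′ = (h)·W ⇒ W ⊆ D(J′)`, so `c′ ≤ λ(T/WT)`
  for the weak transform `W` — the lengths of `RadicialJungCleanModelsGiraudPointBound.lean` /
  `…GiraudCaseAB.lean` bound `c′`;
* `colength_add_one_le_of_crossing` — **(i)**: `D♯ = D` (both branches logarithmic, (C1)):
  `c′ + 1 ≤ c` at every point of the chart (2.1.1 at one point);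
* `colength_nonCrossing_chart` — **(ii) + (iii) on the chart of the exceptional equation `x`**
  (`E(f) = div(x)`, (C2): `D♯ = D′ = D₀ + (xB)` where `D = D₀ + (B)`): at every point `Q ∋ x`,
  EITHER `c′ + 1 ≤ c` OR `D(J′) = ⊤` (`c′ = 0`); the second alternative is what case (B) with
  `m = 1` gives through the exactness inclusion `D₀ ⊆ xR + 𝔪²` of
  `RadicialJungCleanModelsGiraudExactness.lean` (hypothesis `hex`, discharged there from
  `ω = df` and a `p`-basis) — "le seul zéro de `H′` est le point de croisement";
* `colength_le_of_nonCrossing_oppositeChart` — **(ii) at the points of the other chart `R[x/y]`**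
  ((C1) with the roles of `x, y` exchanged: `D♯ = D₀ + (yB)`): `c′ ≤ c` (at the crossing point
  of `E(ω′)` the flag `δ` drops from `1` to `0`, which is what the T2 measure `2c + δ` needs).

References: J. Giraud, Bull. SMF 111 (1983), Lemme 2.1.1, Lemme 2.3, 2.5, 2.6 [Giraud1983].
-/

noncomputable section

set_option linter.dupNamespace false -- mandated namespace of this single-conjunct summit

open IsLocalRing Literature.AlgebraicGeometry.Resolution

namespace Summit.ResolutionOfSingularities.ResolutionOfSingularities.Theorems.RadicialJung.CleanModels

universe u v

/-! ## Generalities -/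

section General

variable {O : Type u} [CommRing O]

/-- **If `J′ ⊆ (h)` and `(h)·W ⊆ J′` then `W ⊆ D(J′)`** (`B(J′) ⊆ (h)`, so `W·B(J′) ⊆ J′`). In
particular the weak transform bounds Giraud's `D` of the transform from below.
[cite: Giraud1983, 2.1 (2)] -/
theorem le_coprincipalPart_of_span_singleton_mul_le {I W : Ideal O} {h : O}
    (hI : I ≤ Ideal.span {h}) (hW : Ideal.span {h} * W ≤ I) : W ≤ coprincipalPart I := by
  intro w hw
  rw [mem_coprincipalPart_iff]
  intro b hb
  obtain ⟨r, rfl⟩ := Ideal.mem_span_singleton'.mp (principalHullIdeal_le_span_singleton hI hb)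
  have e : w * (r * h) = r * (h * w) := by ring
  rw [e]
  exact I.mul_mem_left r (hW (Ideal.mul_mem_mul (Ideal.mem_span_singleton_self h) hw))

/-- `λ(O/D) ≤ λ(O/W)` for `W ⊆ D`. [folklore] -/
theorem length_quotient_le_of_le {W D : Ideal O} (h : W ≤ D) :
    Module.length O (O ⧸ D) ≤ Module.length O (O ⧸ W) :=
  Module.length_le_of_surjective (Submodule.factor h) (Submodule.factor_surjective h)

/-- `1 ≤ λ(M)` for a nontrivial module. [folklore] -/
theorem one_le_length_of_nontrivial {R M : Type*} [Ring R] [AddCommGroup M] [Module R M]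
    [Nontrivial M] : (1 : ℕ∞) ≤ Module.length R M :=
  Order.one_le_iff_pos.mpr Module.length_pos

/-- Arithmetic of the point bounds: `a·b + k ≤ c`, `1 ≤ a`, `1 ≤ k`, `b′ ≤ b` give `b′ + 1 ≤ c`.
[folklore] -/
theorem add_one_le_of_mul_add_le {a b b' k c : ℕ∞} (h : a * b + k ≤ c) (ha : 1 ≤ a)
    (hk : 1 ≤ k) (hb : b' ≤ b) : b' + 1 ≤ c :=
  le_trans (add_le_add (hb.trans (le_mul_of_one_le_left zero_le ha)) hk) h

/-- Arithmetic of the point bounds with a correction: `a·b + k ≤ c + m`, `1 ≤ a`, `m + j ≤ k`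
(`m` finite), `b′ ≤ b` give `b′ + j ≤ c`. [folklore] -/
theorem add_le_of_mul_add_le_add {a b b' k c j : ℕ∞} {m : ℕ} (h : a * b + k ≤ c + m)
    (ha : 1 ≤ a) (hk : (m : ℕ∞) + j ≤ k) (hb : b' ≤ b) : b' + j ≤ c := by
  have h1 : b' + j + m ≤ c + m := by
    calc b' + j + m = b' + (m + j) := by rw [add_assoc, add_comm j]
      _ ≤ a * b + k := add_le_add (hb.trans (le_mul_of_one_le_left zero_le ha)) hk
      _ ≤ c + m := h
  exact (WithTop.add_le_add_iff_right (WithTop.natCast_ne_top m)).mp h1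

end General

/-! ## The three chart situations -/

section Chart

variable {K : Type u} [Field K] {R : Subring K} [IsRegularLocalRing R] {x y : R}

/-- Pushing `D A = (x^r)·W` to the local ring `T` and combining with `J′ = (g)·(DA)T`:
`J′ = (g·x^r)·W_T`, hence `W_T ⊆ D(J′)` and `λ_T(T/D(J′)) ≤ λ_T(T/W_T)`. [folklore] -/
theorem length_quotient_coprincipalPart_le_of_chart (hm : maximalIdeal R = Ideal.span {x, y})
    (hx0 : x ≠ 0) {D : Ideal R} {r : ℕ} (hD : D ≤ maximalIdeal R ^ r)
    {T : Type v} [CommRing T] [Algebra (chartAdjoin (K := K) x y) T] {J' : Ideal T} {g : T}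
    (hJ' : J' = Ideal.span {g} *
      (D.map (chartIncl (K := K) x y)).map (algebraMap (chartAdjoin (K := K) x y) T)) :
    (weakTransformChart (K := K) x y D r).map (algebraMap (chartAdjoin (K := K) x y) T) ≤
        coprincipalPart J' ∧
      Module.length T (T ⧸ coprincipalPart J') ≤ Module.length T
        (T ⧸ (weakTransformChart (K := K) x y D r).map (algebraMap (chartAdjoin (K := K) x y) T)) := by
  set φ := algebraMap (chartAdjoin (K := K) x y) T with hφ
  set W := weakTransformChart (K := K) x y D r with hW
  have hDA := map_eq_span_pow_mul_weakTransform (K := K) hm hx0 hD (r := r)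
  have hJ'' : J' = Ideal.span {g * φ (chartIncl x y x) ^ r} * W.map φ := by
    rw [hJ', hDA, Ideal.map_mul, Ideal.map_span, Set.image_singleton, map_pow, ← mul_assoc,
      Ideal.span_singleton_mul_span_singleton]
  have hle : W.map φ ≤ coprincipalPart J' :=
    le_coprincipalPart_of_span_singleton_mul_le (h := g * φ (chartIncl x y x) ^ r)
      (by rw [hJ'']; exact Ideal.mul_le_right) (by rw [hJ''])
  exact ⟨hle, length_quotient_le_of_le hle⟩

/-- If the weak transform is not contained in `Q`, it generates the unit ideal of `T = A_Q`, so
`D(J′) = ⊤` (`c′ = 0`). [folklore] -/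
theorem coprincipalPart_eq_top_of_not_le {A : Type u} [CommRing A] {W Q : Ideal A} [Q.IsPrime]
    (hWQ : ¬ W ≤ Q) {T : Type v} [CommRing T] [Algebra A T] [IsLocalization.AtPrime T Q]
    {I : Ideal T} (hle : W.map (algebraMap A T) ≤ coprincipalPart I) : coprincipalPart I = ⊤ := by
  obtain ⟨s, hsW, hsQ⟩ := Set.not_subset.mp hWQ
  have hu : IsUnit (algebraMap A T s) :=
    IsLocalization.map_units T (⟨s, show s ∈ Q.primeCompl from hsQ⟩ : Q.primeCompl)
  exact Ideal.eq_top_of_isUnit_mem _ (hle (Ideal.mem_map_of_mem _ hsW)) hu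

/-- **Lemme 2.3 (i) at one point (crossing case; also the shape of 2.1.1 at one point).** Let
`D ⊆ 𝔪ᵐ`, `D ⊄ 𝔪ᵐ⁺¹`, `m ≥ 1`, `R/D` of finite length (Giraud's `D(J)` at a point of `Sing`),
`A = R[y/x]`, `Q` a maximal ideal of `A`, `T = A_Q`, and `J′ = (g)·(DA)T` for some `g ∈ T` (for the
crossing case `g = xᵃyᵇ`, by (C1) `J′ = J·T`, `J = xᵃyᵇD`). Then `λ_T(T/D(J′)) + 1 ≤ λ_R(R/D)`:
**`c′ < c`**. [cite: Giraud1983, Lemme 2.3 (i) and Lemme 2.1.1] -/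
theorem colength_add_one_le_of_crossing (hdim : ringKrullDim R = 2)
    (hm : maximalIdeal R = Ideal.span {x, y}) {D : Ideal R} {m : ℕ} (hm1 : 1 ≤ m)
    (hD : D ≤ maximalIdeal R ^ m) (hDm : ¬ D ≤ maximalIdeal R ^ (m + 1))
    (hfin : IsFiniteLength R (R ⧸ D)) [Algebra R (chartAdjoin (K := K) x y)]
    (halg : algebraMap R (chartAdjoin (K := K) x y) = chartIncl x y)
    (Q : Ideal (chartAdjoin (K := K) x y)) [Q.IsMaximal]
    (T : Type u) [CommRing T] [Algebra (chartAdjoin (K := K) x y) T] [IsLocalization.AtPrime T Q]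
    {J' : Ideal T} {g : T}
    (hJ' : J' = Ideal.span {g} *
      (D.map (chartIncl (K := K) x y)).map (algebraMap (chartAdjoin (K := K) x y) T)) :
    Module.length T (T ⧸ coprincipalPart J') + 1 ≤ Module.length R (R ⧸ D) := by
  have hx0 : x ≠ 0 := fun h => fst_not_mem_sq hdim hm (by rw [h]; exact Ideal.zero_mem _)
  obtain ⟨hle, hc'⟩ := length_quotient_coprincipalPart_le_of_chart (K := K) hm hx0 hD (r := m) hJ'
  set W := weakTransformChart (K := K) x y D m with hW
  -- `1 ≤ λ(R/D)`
  have hmle : maximalIdeal R ^ m ≤ maximalIdeal R := Ideal.pow_le_self (by omega)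
  have hntR : Nontrivial (R ⧸ D) :=
    Ideal.Quotient.nontrivial_iff.mpr (fun h => (maximalIdeal.isMaximal R).ne_top
      (top_le_iff.mp (h ▸ hD.trans hmle)))
  by_cases hWQ : W ≤ Q
  · have hpt := length_quotient_mul_length_atPrime_weakTransform_add_choose_le (K := K) hdim hm hD
      hDm hfin halg Q hWQ T
    have hntA : Nontrivial (chartAdjoin (K := K) x y ⧸ Q) :=
      Ideal.Quotient.nontrivial_iff.mpr (Ideal.IsMaximal.ne_top ‹_›)
    refine add_one_le_of_mul_add_le hpt one_le_length_of_nontrivial ?_ hc'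
    have : 1 ≤ m * (m + 1) / 2 := by
      have h2 : 2 ≤ m * (m + 1) := by nlinarith
      omega
    exact_mod_cast this
  · rw [coprincipalPart_eq_top_of_not_le hWQ hle]
    haveI : Subsingleton (T ⧸ (⊤ : Ideal T)) := Ideal.Quotient.subsingleton_iff.mpr rfl
    rw [Module.length_eq_zero_iff.mpr ‹_›, zero_add]
    exact one_le_length_of_nontrivial

/-- **Lemme 2.3 (ii)/(iii) at one point of the chart of the exceptional equation** (`E(f) = div(x)`,
`A = R[y/x]`, `Q ∋ x` a point of the exceptional curve, `T = A_Q`). Data: `D(J) = D₀ + (B)` of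
order `m ≥ 1` and finite colength (Giraud's `(A, C_ν) + (B)`), and by (C2) `J′ = (g)·(D′A)T` with
`D′ = D₀ + (xB)`. Hypothesis `hex` = the exactness inclusion `D₀ ⊆ xR + 𝔪²` of
`giraud_exactness` (needed only when `m = 1` and `D₀ ⊄ 𝔪²`, i.e. in Giraud's case (B) with
`m = 1`). Conclusion: **`c′ + 1 ≤ c`, or `D(J′) = ⊤` (`c′ = 0`)** — case (A): `c′ ≤ c − m(m+1)/2`;
case (B), `m ≥ 2`: `c′ ≤ c − m(m−1)/2`; case (B), `m = 1`: the weak transform of `D′` has no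
zero on the exceptional curve of this chart. [cite: Giraud1983, Lemme 2.3 (ii)–(iii), 2.5, 2.6] -/
theorem colength_nonCrossing_chart (hdim : ringKrullDim R = 2)
    (hm : maximalIdeal R = Ideal.span {x, y}) {D₀ : Ideal R} {B : R} {m : ℕ} (hm1 : 1 ≤ m)
    (hD : D₀ ⊔ Ideal.span {B} ≤ maximalIdeal R ^ m)
    (hDm : ¬ D₀ ⊔ Ideal.span {B} ≤ maximalIdeal R ^ (m + 1))
    (hfin : IsFiniteLength R (R ⧸ (D₀ ⊔ Ideal.span {B})))
    (hex : m = 1 → ¬ D₀ ≤ maximalIdeal R ^ 2 → D₀ ≤ Ideal.span {x} ⊔ maximalIdeal R ^ 2)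
    [Algebra R (chartAdjoin (K := K) x y)]
    (halg : algebraMap R (chartAdjoin (K := K) x y) = chartIncl x y)
    (Q : Ideal (chartAdjoin (K := K) x y)) [Q.IsMaximal] (hxQ : chartIncl x y x ∈ Q)
    (T : Type u) [CommRing T] [Algebra (chartAdjoin (K := K) x y) T] [IsLocalization.AtPrime T Q]
    {J' : Ideal T} {g : T}
    (hJ' : J' = Ideal.span {g} *
      ((D₀ ⊔ Ideal.span {x * B}).map (chartIncl (K := K) x y)).map
        (algebraMap (chartAdjoin (K := K) x y) T)) :
    Module.length T (T ⧸ coprincipalPart J') + 1 ≤ Module.length R (R ⧸ (D₀ ⊔ Ideal.span {B})) ∨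
      coprincipalPart J' = ⊤ := by
  have hx0 : x ≠ 0 := fun h => fst_not_mem_sq hdim hm (by rw [h]; exact Ideal.zero_mem _)
  have hxm : x ∈ maximalIdeal R := hm ▸ Ideal.subset_span (by simp)
  have hB : B ∈ maximalIdeal R ^ m :=
    hD (Submodule.mem_sup_right (Ideal.mem_span_singleton_self B))
  have hD₀m : D₀ ≤ maximalIdeal R ^ m := le_trans le_sup_left hD
  have hxB : x * B ∈ maximalIdeal R ^ (m + 1) := by
    rw [pow_succ']; exact Ideal.mul_mem_mul hxm hB
  have hntA : Nontrivial (chartAdjoin (K := K) x y ⧸ Q) :=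
    Ideal.Quotient.nontrivial_iff.mpr (Ideal.IsMaximal.ne_top ‹_›)
  by_cases hA : D₀ ≤ maximalIdeal R ^ (m + 1)
  · -- case (A): `ord D′ = m + 1`
    have hB' : B ∉ maximalIdeal R ^ (m + 1) := fun h =>
      hDm (sup_le hA ((Ideal.span_singleton_le_iff_mem _).mpr h))
    have hD' : D₀ ⊔ Ideal.span {x * B} ≤ maximalIdeal R ^ (m + 1) :=
      sup_le hA ((Ideal.span_singleton_le_iff_mem _).mpr hxB)
    obtain ⟨hle, hc'⟩ :=
      length_quotient_coprincipalPart_le_of_chart (K := K) hm hx0 hD' (r := m + 1) hJ'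
    by_cases hWQ : weakTransformChart (K := K) x y (D₀ ⊔ Ideal.span {x * B}) (m + 1) ≤ Q
    · left
      have hpt := length_mul_length_atPrime_caseA_add_le (K := K) hdim hm hA hB hB' hfin halg Q
        hWQ T
      refine add_one_le_of_mul_add_le hpt one_le_length_of_nontrivial ?_ hc'
      have : 1 ≤ m * (m + 1) / 2 := by
        have h2 : 2 ≤ m * (m + 1) := by nlinarith
        omega
      exact_mod_cast this
    · right; exact coprincipalPart_eq_top_of_not_le hWQ hle
  · -- case (B): an element of `D₀` of order exactly `m`; `ord D′ = m`
    obtain ⟨φ₀, hφ₀, hφ₀'⟩ := SetLike.not_le_iff_exists.mp hA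
    have hD' : D₀ ⊔ Ideal.span {x * B} ≤ maximalIdeal R ^ m :=
      sup_le hD₀m ((Ideal.span_singleton_le_iff_mem _).mpr
        (Ideal.pow_le_pow_right (Nat.le_succ m) hxB))
    obtain ⟨hle, hc'⟩ :=
      length_quotient_coprincipalPart_le_of_chart (K := K) hm hx0 hD' (r := m) hJ'
    by_cases hWQ : weakTransformChart (K := K) x y (D₀ ⊔ Ideal.span {x * B}) m ≤ Q
    · rcases Nat.lt_or_ge 1 m with hm2 | hm2
      · -- `m ≥ 2`: `c′ ≤ c − m(m−1)/2 ≤ c − 1`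
        left
        have hpt := length_mul_length_atPrime_caseB_add_le (K := K) hdim hm hD₀m hφ₀ hφ₀' hB
          hfin halg Q hWQ T
        refine add_le_of_mul_add_le_add hpt one_le_length_of_nontrivial ?_ hc'
        have : m + 1 ≤ m * (m + 1) / 2 := by
          have h2 : 2 * (m + 1) ≤ m * (m + 1) := by nlinarith
          omega
        exact_mod_cast this
      · -- `m = 1`: exactness ⇒ the weak transform has no zero at `Q`
        exfalso
        have hm1' : m = 1 := le_antisymm hm2 hm1
        subst hm1'
        have hD₀x := hex rfl hA
        exact not_weakTransformChart_le_of_le (K := K) hdim hm hD₀x hφ₀ hφ₀' B Q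
          (Ideal.IsMaximal.ne_top ‹_›) hxQ hWQ
    · right; exact coprincipalPart_eq_top_of_not_le hWQ hle

/-- **Lemme 2.3 (ii) at the points of the other chart** `A′ = R[x/y]` (exceptional equation
`y`; in particular the crossing point `(y, x/y)` of `E(ω′)`, the only point of the exceptional
curve outside the chart of `x`). Data as in `colength_nonCrossing_chart`; by (C1) with the roles
of `x, y` exchanged, `J′ = (g)·((D₀ + (yB))A′)T` (Giraud's `H′ = y⁻ᵐ(A + yB, A, C_ν)R′`).
Conclusion: **`c′ ≤ c`** (case (A): `c′ ≤ c − m(m+1)/2`; case (B): `c′ ≤ c − m(m−1)/2`).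
[cite: Giraud1983, Lemme 2.3 (ii), 2.5] -/
theorem colength_le_of_nonCrossing_oppositeChart (hdim : ringKrullDim R = 2)
    (hm : maximalIdeal R = Ideal.span {x, y}) {D₀ : Ideal R} {B : R} {m : ℕ} (hm1 : 1 ≤ m)
    (hD : D₀ ⊔ Ideal.span {B} ≤ maximalIdeal R ^ m)
    (hDm : ¬ D₀ ⊔ Ideal.span {B} ≤ maximalIdeal R ^ (m + 1))
    (hfin : IsFiniteLength R (R ⧸ (D₀ ⊔ Ideal.span {B})))
    [Algebra R (chartAdjoin (K := K) y x)]
    (halg : algebraMap R (chartAdjoin (K := K) y x) = chartIncl y x)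
    (Q : Ideal (chartAdjoin (K := K) y x)) [Q.IsMaximal]
    (T : Type u) [CommRing T] [Algebra (chartAdjoin (K := K) y x) T] [IsLocalization.AtPrime T Q]
    {J' : Ideal T} {g : T}
    (hJ' : J' = Ideal.span {g} *
      ((D₀ ⊔ Ideal.span {y * B}).map (chartIncl (K := K) y x)).map
        (algebraMap (chartAdjoin (K := K) y x) T)) :
    Module.length T (T ⧸ coprincipalPart J') ≤ Module.length R (R ⧸ (D₀ ⊔ Ideal.span {B})) := by
  have hm' : maximalIdeal R = Ideal.span {y, x} := by rw [hm, Set.pair_comm]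
  have hy0 : y ≠ 0 := fun h => fst_not_mem_sq hdim hm' (by rw [h]; exact Ideal.zero_mem _)
  have hym : y ∈ maximalIdeal R := hm ▸ Ideal.subset_span (by simp)
  have hB : B ∈ maximalIdeal R ^ m :=
    hD (Submodule.mem_sup_right (Ideal.mem_span_singleton_self B))
  have hD₀m : D₀ ≤ maximalIdeal R ^ m := le_trans le_sup_left hD
  have hyB : y * B ∈ maximalIdeal R ^ (m + 1) := by
    rw [pow_succ']; exact Ideal.mul_mem_mul hym hB
  have hntA : Nontrivial (chartAdjoin (K := K) y x ⧸ Q) :=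
    Ideal.Quotient.nontrivial_iff.mpr (Ideal.IsMaximal.ne_top ‹_›)
  -- `c′ = 0` when the weak transform misses `Q`
  have hzero : ∀ {W : Ideal (chartAdjoin (K := K) y x)}, ¬ W ≤ Q →
      W.map (algebraMap _ T) ≤ coprincipalPart J' →
      Module.length T (T ⧸ coprincipalPart J') ≤ Module.length R (R ⧸ (D₀ ⊔ Ideal.span {B})) := by
    intro W hWQ hle
    rw [coprincipalPart_eq_top_of_not_le hWQ hle]
    haveI : Subsingleton (T ⧸ (⊤ : Ideal T)) := Ideal.Quotient.subsingleton_iff.mpr rfl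
    rw [Module.length_eq_zero_iff.mpr ‹_›]
    exact bot_le
  by_cases hA : D₀ ≤ maximalIdeal R ^ (m + 1)
  · -- case (A)
    have hB' : B ∉ maximalIdeal R ^ (m + 1) := fun h =>
      hDm (sup_le hA ((Ideal.span_singleton_le_iff_mem _).mpr h))
    have hD' : D₀ ⊔ Ideal.span {y * B} ≤ maximalIdeal R ^ (m + 1) :=
      sup_le hA ((Ideal.span_singleton_le_iff_mem _).mpr hyB)
    obtain ⟨hle, hc'⟩ :=
      length_quotient_coprincipalPart_le_of_chart (K := K) hm' hy0 hD' (r := m + 1) hJ'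
    by_cases hWQ : weakTransformChart (K := K) y x (D₀ ⊔ Ideal.span {y * B}) (m + 1) ≤ Q
    · have hpt := length_mul_length_atPrime_caseA_add_le (K := K) hdim hm' hA hB hB' hfin halg Q
        hWQ T
      have h1 := add_one_le_of_mul_add_le hpt one_le_length_of_nontrivial (by
        have : 1 ≤ m * (m + 1) / 2 := by
          have h2 : 2 ≤ m * (m + 1) := by nlinarith
          omega
        exact_mod_cast this) hc'
      exact le_trans le_self_add h1
    · exact hzero hWQ hle
  · -- case (B)
    obtain ⟨φ₀, hφ₀, hφ₀'⟩ := SetLike.not_le_iff_exists.mp hA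
    have hD' : D₀ ⊔ Ideal.span {y * B} ≤ maximalIdeal R ^ m :=
      sup_le hD₀m ((Ideal.span_singleton_le_iff_mem _).mpr
        (Ideal.pow_le_pow_right (Nat.le_succ m) hyB))
    obtain ⟨hle, hc'⟩ :=
      length_quotient_coprincipalPart_le_of_chart (K := K) hm' hy0 hD' (r := m) hJ'
    by_cases hWQ : weakTransformChart (K := K) y x (D₀ ⊔ Ideal.span {y * B}) m ≤ Q
    · have hpt := length_mul_length_atPrime_caseB_add_le (K := K) hdim hm' hD₀m hφ₀ hφ₀' hB
        hfin halg Q hWQ T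
      have h0 := add_le_of_mul_add_le_add (j := 0) hpt one_le_length_of_nontrivial (by
        rw [add_zero]
        have : m ≤ m * (m + 1) / 2 := by
          have h2 : 2 * m ≤ m * (m + 1) := by nlinarith
          omega
        exact_mod_cast this) hc'
      rwa [add_zero] at h0
    · exact hzero hWQ hle

end Chart

end Summit.ResolutionOfSingularities.ResolutionOfSingularities.Theorems.RadicialJung.CleanModels

end
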